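import Mathlib.RingTheory.DedekindDomain.AdicValuation
import Mathlib.RingTheory.Ideal.Norm.AbsNorm
import Mathlib.NumberTheory.NumberField.Basic
import Mathlib.Order.Filter.Cofinite
import HarnessLib

/-!
# Valuation boxes `{β ∈ K : |β|_v ≤ R_v for all v}` are sandwiched between two multiples of `𝓞_K`

Topic `NumberTheory/NumberFields`; namespace `Literature.NumberTheory.NumberFields`.  Mathlib
only; theorems.

Let `K` be a number field and `R : v ↦ R_v ∈ ℤₘ₀ ∖ {0}` a family of bounds with `R_v = 1` for
all but finitely many `v`.  The "box" (a fractional ideal, described adelically)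
`Λ_R = {β ∈ K : v(β) ≤ R_v for all finite places v}` satisfies (`exists_sandwich_of_valuation_le`):
there are positive integers `N, N'` with

* `N · 𝓞_K ⊆ Λ_R` (`|N x|_v ≤ R_v` for every algebraic integer `x`), and
* `N' · Λ_R ⊆ 𝓞_K`.

Both integers are powers of the product of the norms of the finitely many exceptional places
(`|Nm v|_v < 1`, Mathlib `Ideal.absNorm_mem`; `|n|_v ≤ 1`, cf. tree
`WeierstrassCurve.OggWild.valuation_natCast_le_one`); an element all of whose valuations are `≤ 1` is an
algebraic integer (Mathlib `HeightOneSpectrum.mem_integers_of_valuation_le_one`).  With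
`SandwichedLattice` this makes `Λ_R` a free `ℤ`-module of rank `[K : ℚ]`.

## References

* J. Neukirch, *Algebraic Number Theory* (1999), Ch. I §3–§4 [NeukirchANT1999].
-/

noncomputable section

open NumberField IsDedekindDomain Filter

namespace Literature.NumberTheory.NumberFields

variable {K : Type*} [Field K] [NumberField K]

/-! ### Powers of a small element of `ℤₘ₀` get below any bound -/

/-- In `ℤₘ₀`: if `0 < a < 1` then some power of `a` is `≤ b` for every `b ≠ 0`. [folklore] -/
theorem exists_pow_le_of_lt_one {a b : WithZero (Multiplicative ℤ)} (ha0 : a ≠ 0) (ha : a < 1)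
    (hb : b ≠ 0) : ∃ k : ℕ, a ^ k ≤ b := by
  rw [← WithZero.exp_log ha0] at ha ⊢
  rw [← WithZero.exp_log hb]
  rw [← WithZero.exp_zero, WithZero.exp_lt_exp] at ha
  refine ⟨(WithZero.log b).natAbs, ?_⟩
  rw [← WithZero.exp_nsmul, WithZero.exp_le_exp, nsmul_eq_mul]
  have h1 : WithZero.log a ≤ -1 := by omega
  have : ((WithZero.log b).natAbs : ℤ) * WithZero.log a ≤ ((WithZero.log b).natAbs : ℤ) * (-1) :=
    mul_le_mul_of_nonneg_left h1 (Int.natCast_nonneg _)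
  refine this.trans ?_
  rw [mul_neg_one]
  omega

/-! ### The norm of a place is small at that place -/

/-- `|Nm(v)|_v < 1`: the absolute norm of `v` lies in `v`. [folklore] -/
theorem valuation_absNorm_lt_one (v : HeightOneSpectrum (𝓞 K)) :
    v.valuation K ((Ideal.absNorm v.asIdeal : ℕ) : K) < 1 := by
  have hmem : ((Ideal.absNorm v.asIdeal : ℕ) : 𝓞 K) ∈ v.asIdeal := Ideal.absNorm_mem _
  have := (v.intValuation_lt_one_iff_mem _).2 hmem
  rw [← v.valuation_of_algebraMap (K := K)] at this
  simpa using this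

/-- For a finite set `S` of places and non-zero bounds `b_v`, some positive integer `M` has
`|M|_v ≤ b_v` for all `v ∈ S` (and `|M|_v ≤ 1` everywhere). [folklore] -/
theorem exists_nat_valuation_le (S : Set (HeightOneSpectrum (𝓞 K))) (hS : S.Finite)
    (b : HeightOneSpectrum (𝓞 K) → WithZero (Multiplicative ℤ)) (hb : ∀ v, b v ≠ 0) :
    ∃ M : ℕ, M ≠ 0 ∧ ∀ v ∈ S, v.valuation K (M : K) ≤ b v := by
  classical
  -- the product of the norms of the places of `S`
  set P : ℕ := ∏ v ∈ hS.toFinset, Ideal.absNorm v.asIdeal with hP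
  have hP0 : P ≠ 0 := Finset.prod_ne_zero_iff.2 fun v _ =>
    Ideal.absNorm_eq_zero_iff.not.2 (by simpa using v.ne_bot)
  have hPv : ∀ v ∈ S, v.valuation K (P : K) < 1 := by
    intro v hv
    rw [hP, Nat.cast_prod, map_prod, ← Finset.mul_prod_erase _ _ (hS.mem_toFinset.2 hv)]
    refine mul_lt_one_of_lt_of_le (valuation_absNorm_lt_one v) ?_
    exact Finset.prod_le_one' fun w _ => by simpa using v.valuation_le_one (K := K) (Ideal.absNorm w.asIdeal : 𝓞 K)
  have hPv0 : ∀ v : HeightOneSpectrum (𝓞 K), v.valuation K (P : K) ≠ 0 := fun v =>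
    (Valuation.ne_zero_iff _).2 (Nat.cast_ne_zero.2 hP0)
  -- a common exponent
  have hk : ∀ v ∈ S, ∃ k : ℕ, v.valuation K (P : K) ^ k ≤ b v := fun v hv =>
    exists_pow_le_of_lt_one (hPv0 v) (hPv v hv) (hb v)
  choose k hk using hk
  refine ⟨P ^ (hS.toFinset.sup fun v => if hv : v ∈ S then k v hv else 0), pow_ne_zero _ hP0,
    fun v hv => ?_⟩
  rw [Nat.cast_pow, map_pow]
  have hle : k v hv ≤ hS.toFinset.sup fun v => if hv : v ∈ S then k v hv else 0 := by
    have := Finset.le_sup (f := fun v => if hv : v ∈ S then k v hv else 0) (hS.mem_toFinset.2 hv)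
    simpa [hv] using this
  exact (pow_le_pow_right_of_le_one' (le_of_lt (hPv v hv)) hle).trans (hk v hv)

/-! ### The sandwich -/

/-- **Valuation boxes are sandwiched**: for bounds `R_v ≠ 0` equal to `1` for almost all `v` there
are `N, N' ∈ ℕ⁺` with `|N x|_v ≤ R_v` for all `x ∈ 𝓞_K` and all `v`, and `N' β ∈ 𝓞_K` whenever
`|β|_v ≤ R_v` for all `v`. [cite: NeukirchANT1999, Ch. I §3–§4] -/
theorem exists_sandwich_of_valuation_le (R : HeightOneSpectrum (𝓞 K) → WithZero (Multiplicative ℤ))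
    (hR0 : ∀ v, R v ≠ 0) (hR1 : ∀ᶠ v in cofinite, R v = 1) :
    ∃ N N' : ℕ, N ≠ 0 ∧ N' ≠ 0 ∧
      (∀ x : 𝓞 K, ∀ v : HeightOneSpectrum (𝓞 K), v.valuation K ((N : K) * x) ≤ R v) ∧
      ∀ β : K, (∀ v : HeightOneSpectrum (𝓞 K), v.valuation K β ≤ R v) →
        ∃ y : 𝓞 K, (N' : K) * β = y := by
  have hfin : {v : HeightOneSpectrum (𝓞 K) | R v ≠ 1}.Finite := hR1
  -- `N`: small at the places where `R_v < 1`
  obtain ⟨N, hN0, hN⟩ := exists_nat_valuation_le {v | R v ≠ 1} hfin R hR0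
  -- `N'`: small at the places where `R_v > 1`, with bound `R_v⁻¹`
  obtain ⟨N', hN'0, hN'⟩ := exists_nat_valuation_le {v | R v ≠ 1} hfin (fun v => (R v)⁻¹)
    fun v => inv_ne_zero (hR0 v)
  refine ⟨N, N', hN0, hN'0, fun x v => ?_, fun β hβ => ?_⟩
  · rw [map_mul]
    by_cases hv : R v = 1
    · rw [hv]
      exact mul_le_one' (by simpa using v.valuation_le_one (K := K) (N : 𝓞 K)) (v.valuation_le_one x)
    · calc v.valuation K (N : K) * v.valuation K (x : K) ≤ R v * 1 :=
            mul_le_mul' (hN v hv) (v.valuation_le_one x)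
        _ = R v := mul_one _
  · have hint : ∀ v : HeightOneSpectrum (𝓞 K), v.valuation K ((N' : K) * β) ≤ 1 := by
      intro v
      rw [map_mul]
      by_cases hv : R v = 1
      · have := hβ v
        rw [hv] at this
        exact mul_le_one' (by simpa using v.valuation_le_one (K := K) (N' : 𝓞 K)) this
      · calc v.valuation K (N' : K) * v.valuation K β ≤ (R v)⁻¹ * R v :=
              mul_le_mul' (hN' v hv) (hβ v)
          _ = 1 := inv_mul_cancel₀ (hR0 v)
    obtain ⟨y, hy⟩ := HeightOneSpectrum.mem_integers_of_valuation_le_one K _ hint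
    exact ⟨y, hy.symm⟩

end Literature.NumberTheory.NumberFields
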